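import Summits.CriticalPhenomena.PercolationContinuityZ3.Theorems.PercNearOneGluingNoHeavyConstsHardCoreBHK
import HarnessLib

/-!
# Hard-core reduction of `Consts.HardCoreBHK`, I: locality off the pairs meeting the repelled set, fibre decompositions, the star split

builds on p205010 (kernel theorem, internal audit signed; external expert review pending).  Support file (`--supports
stmt-CriticalPhenomena-4575`), lead seat `prim-nh-lead-4575` (gen 105); memo `run/shared/lean/prim/prim-nh-lead-4575/LEAD-GEN105.md` §1(1).
Theorems only; no sorries; standard axioms; default heartbeats.

The REDUCTION THEOREM (`…ConstsHardCoreReduction.lean`, `Consts.HardCoreReduction.hardCoreBHK_iff_hardCoreHarris`): the fibrewise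
van den Berg–Häggström–Kahn conjecture with a repelled set `T` on both copies (`Consts.HardCoreBHK`, which implies `Consts.FibrewiseBHK`
= PA-BERN by `Consts.fibrewiseBHK_of_hardCoreBHK`) is EQUIVALENT to its slice `T = ∅` ("hard-core Harris": two copies `a`, `a ∆ M` of a
folding fibre, a hard-core set `N` met by at most one of the two union clusters, increasing cluster events `P`, `Q`; no disconnection
event at all).  The proof is BHK's block step made fibrewise, organised as a per-vertex recursion on the pairs `s(v, t)`, `t ∈ T`.
This file supplies its three ingredients:

* LOCALITY (`reachable_iff_reachable_sdiff_touch`, `openEdgeCluster_eq_sdiff_touch`, `iUnion_openEdgeCluster_eq_sdiff_touch`, and the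
  block versions `…_sdiff_block`): on `{S ↮ T}` the union cluster `C_S` is read in the configuration with the pairs meeting `T` deleted;
* GENERIC FIBRE DECOMPOSITIONS on `Set α` (`card_filter_fibre_split`: the bijection `a ↦ (a \ F, a ∩ F)` along a block `F ⊆ M` of
  reflected coordinates; `card_filter_fibre_forced`: deleting a block `F ⊆ u` of coordinates open in both copies;
  `card_filter_subset_rel`: the block count in the four compatibility states);
* the STAR SPLIT `not_reachable_iff_sdiff_star`: `S ↮ T` in `ω` iff `S ↮ T` in `ω \ F` and (`v` joined to `S` in `ω \ F` ⇒ no pair of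
  `F` open), for `F` a set of pairs `s(v, t)`, `t ∈ T`.
[cite: VandenbergHaggstromKahn2005, Thm. 1.1 proof (pp. 3–5): conditioning on the edges at `Z = X ∩ Y`, identity (6)]
-/

namespace Summit.CriticalPhenomena.PercolationContinuityZ3.Theorems

open Set Literature.Probability.Percolation
open scoped Classical symmDiff

namespace Consts.HardCoreReduction


variable {V : Type*}

/-- Deleting pairs only removes open paths. [folklore] -/
theorem reachable_of_reachable_sdiff {ω F : BondConfig V} {s v : V}
    (h : (openGraph (ω \ F)).Reachable s v) : (openGraph ω).Reachable s v :=
  h.mono (openGraph_mono Set.sdiff_subset)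

/-- **Locality of connections from `S` on `{S ↮ T}`.**  If no vertex of `T` is joined to `s` in `ω`, then a vertex is joined to `s`
in `ω` iff it is joined to `s` in the configuration `ω \ touch T` with all pairs meeting `T` deleted (an open path from `s` visits no
vertex of `T`, hence uses no pair meeting `T`). [cite: VandenbergHaggstromKahn2005, §1 p. 4 (identity (6): on `R_W`, `W ⊇ Z`, events of `C_s` are events of percolation on `G − Z`)] -/
theorem reachable_iff_reachable_sdiff_touch {ω : BondConfig V} {s : V} {T : Set V}
    (hT : ∀ t ∈ T, ¬ (openGraph ω).Reachable s t) (v : V) :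
    (openGraph ω).Reachable s v ↔ (openGraph (ω \ {e | ∃ t ∈ T, t ∈ e})).Reachable s v := by
  refine ⟨fun h => ?_, reachable_of_reachable_sdiff⟩
  rw [SimpleGraph.reachable_iff_reflTransGen] at h
  induction h with
  | refl => exact SimpleGraph.Reachable.refl s
  | @tail b c hsb hbc ih =>
    have hb : (openGraph ω).Reachable s b := (SimpleGraph.reachable_iff_reflTransGen s b).2 hsb
    obtain ⟨hω, hne⟩ := (openGraph_adj ω b c).1 hbc
    have hc : (openGraph ω).Reachable s c := hb.trans (SimpleGraph.Adj.reachable hbc)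
    -- the pair `s(b, c)` meets no vertex of `T`: both its endpoints are joined to `s`
    have hnot : s(b, c) ∉ {e : Sym2 V | ∃ t ∈ T, t ∈ e} := by
      rintro ⟨t, ht, hte⟩
      rcases Sym2.mem_iff.1 hte with rfl | rfl
      · exact hT _ ht hb
      · exact hT _ ht hc
    exact ih.trans (SimpleGraph.Adj.reachable ((openGraph_adj _ b c).2 ⟨⟨hω, hnot⟩, hne⟩))

/-- **Locality of the edge cluster**: on `{s ↮ T}`, `C_s(ω) = C_s(ω \ touch T)`. [cite: VandenbergHaggstromKahn2005, §1 p. 4 (identity (6))] -/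
theorem openEdgeCluster_eq_sdiff_touch {ω : BondConfig V} {s : V} {T : Set V}
    (hT : ∀ t ∈ T, ¬ (openGraph ω).Reachable s t) :
    openEdgeCluster ω s = openEdgeCluster (ω \ {e | ∃ t ∈ T, t ∈ e}) s := by
  ext e
  rw [mem_openEdgeCluster_iff, mem_openEdgeCluster_iff]
  constructor
  · rintro ⟨he, hd, hr⟩
    have hr' : ∀ v ∈ e, (openGraph (ω \ {e | ∃ t ∈ T, t ∈ e})).Reachable s v :=
      fun v hv => (reachable_iff_reachable_sdiff_touch hT v).1 (hr v hv)
    refine ⟨⟨he, ?_⟩, hd, hr'⟩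
    rintro ⟨t, ht, hte⟩
    exact hT t ht (hr t hte)
  · rintro ⟨he, hd, hr⟩
    exact ⟨he.1, hd, fun v hv => reachable_of_reachable_sdiff (hr v hv)⟩

/-- **Locality of the union cluster `C_S`**: on `{S ↮ T}`, `C_S(ω) = C_S(ω \ touch T)`. [cite: VandenbergHaggstromKahn2005, §1 p. 4 (identity (6)) with Remark 1 after Thm. 1.2 (sets)] -/
theorem iUnion_openEdgeCluster_eq_sdiff_touch {ω : BondConfig V} {S T : Set V}
    (hT : ∀ s ∈ S, ∀ t ∈ T, ¬ (openGraph ω).Reachable s t) :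
    (⋃ s ∈ S, openEdgeCluster ω s) = ⋃ s ∈ S, openEdgeCluster (ω \ {e | ∃ t ∈ T, t ∈ e}) s :=
  Set.iUnion₂_congr fun s hs => openEdgeCluster_eq_sdiff_touch (hT s hs)

/-- **Locality of the footprint**: on `{S ↮ T}`, a vertex is joined to `S` in `ω` iff it is joined to `S` off `touch T`. [folklore] -/
theorem exists_reachable_iff_sdiff_touch {ω : BondConfig V} {S T : Set V}
    (hT : ∀ s ∈ S, ∀ t ∈ T, ¬ (openGraph ω).Reachable s t) (v : V) :
    (∃ s ∈ S, (openGraph ω).Reachable s v) ↔ ∃ s ∈ S, (openGraph (ω \ {e | ∃ t ∈ T, t ∈ e})).Reachable s v :=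
  ⟨fun ⟨s, hs, h⟩ => ⟨s, hs, (reachable_iff_reachable_sdiff_touch (hT s hs) v).1 h⟩,
    fun ⟨s, hs, h⟩ => ⟨s, hs, reachable_of_reachable_sdiff h⟩⟩


/-! ### Generic fibre decomposition along a removable block of coordinates -/

section Generic

variable {α : Type*}

/-- `(a ∆ M) \ F = (a \ F) ∆ (M \ F)`. [folklore] -/
theorem symmDiff_sdiff_eq (a M F : Set α) : (a ∆ M) \ F = (a \ F) ∆ (M \ F) := by
  ext e
  simp only [Set.mem_sdiff, Set.mem_symmDiff]
  tauto

/-- `(a ∆ M) ∩ F = F \ a` when `F ⊆ M`. [folklore] -/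
theorem symmDiff_inter_eq_sdiff_of_subset {a M F : Set α} (hFM : F ⊆ M) : (a ∆ M) ∩ F = F \ (a ∩ F) := by
  ext e
  simp only [Set.mem_inter_iff, Set.mem_symmDiff, Set.mem_sdiff]
  constructor
  · rintro ⟨h, heF⟩
    rcases h with ⟨hea, heM⟩ | ⟨heM, hea⟩
    · exact absurd (hFM heF) heM
    · exact ⟨heF, fun h => hea h.1⟩
  · rintro ⟨heF, hna⟩
    exact ⟨Or.inr ⟨hFM heF, fun hea => hna ⟨hea, heF⟩⟩, heF⟩

variable [Fintype α]

/-- **Fibre decomposition along a block `F ⊆ M` of split coordinates.**  If, on the folding fibre `{a : a \ M = u}`, a condition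
`Cond a` only depends on `x = a \ F` (through `Good x`) and on the block `y = a ∩ F` through a relation `Rel x y`, then
`#{a : a \ M = u, Cond a} = Σ_{x : x \ (M \ F) = u, Good x} #{y ⊆ F : Rel x y}` (the bijection `a ↦ (a \ F, a ∩ F)`). [folklore] -/
theorem card_filter_fibre_split (M u F : Set α) (hFM : F ⊆ M) (huF : Disjoint u F)
    (Cond Good : Set α → Prop) (Rel : Set α → Set α → Prop)
    (h : ∀ a : Set α, a \ M = u → (Cond a ↔ Good (a \ F) ∧ Rel (a \ F) (a ∩ F))) :
    (Finset.univ.filter fun a : Set α => a \ M = u ∧ Cond a).card =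
      ∑ x ∈ Finset.univ.filter (fun x : Set α => x \ (M \ F) = u ∧ Good x),
        (Finset.univ.filter fun y : Set α => y ⊆ F ∧ Rel x y).card := by
  classical
  -- set algebra on the fibre
  have hsd : ∀ a : Set α, a \ M = u → (a \ F) \ (M \ F) = u := by
    intro a ha
    rw [Set.sdiff_sdiff, Set.union_sdiff_cancel hFM, ha]
  have hxF : ∀ x : Set α, x \ (M \ F) = u → x ∩ F = ∅ := by
    intro x hx
    ext e
    simp only [Set.mem_inter_iff, Set.mem_empty_iff_false, iff_false, not_and]
    intro hex heF
    have : e ∈ x \ (M \ F) := ⟨hex, fun h => h.2 heF⟩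
    rw [hx] at this
    exact Set.disjoint_left.1 huF this heF
  set s : Finset (Set α) := Finset.univ.filter fun a : Set α => a \ M = u ∧ Cond a with hs
  set t : Finset (Set α) := Finset.univ.filter fun x : Set α => x \ (M \ F) = u ∧ Good x with ht
  have hmaps : Set.MapsTo (fun a : Set α => a \ F) (s : Set (Set α)) (t : Set (Set α)) := by
    intro a ha
    have ha' := (Finset.mem_filter.1 (Finset.mem_coe.1 ha)).2
    refine Finset.mem_coe.2 (Finset.mem_filter.2 ⟨Finset.mem_univ _, hsd a ha'.1, ((h a ha'.1).1 ha'.2).1⟩)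
  rw [Finset.card_eq_sum_card_fiberwise hmaps]
  refine Finset.sum_congr rfl fun x hx => ?_
  have hx' := (Finset.mem_filter.1 hx).2
  have hxF' := hxF x hx'.1
  -- the fibre over `x` is in bijection with `{y ⊆ F : Rel x y}` via `a ↦ a ∩ F`, `y ↦ x ∪ y`
  refine Finset.card_nbij' (fun a : Set α => a ∩ F) (fun y : Set α => x ∪ y) ?_ ?_ ?_ ?_
  · intro a ha
    have ha1 := Finset.mem_filter.1 (Finset.mem_coe.1 ha)
    have ha2 := (Finset.mem_filter.1 ha1.1).2
    have hax : a \ F = x := ha1.2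
    refine Finset.mem_coe.2 (Finset.mem_filter.2 ⟨Finset.mem_univ _, Set.inter_subset_right, ?_⟩)
    have := ((h a ha2.1).1 ha2.2).2
    rwa [hax] at this
  · intro y hy
    have hy' := (Finset.mem_filter.1 (Finset.mem_coe.1 hy)).2
    have hyF : y ⊆ F := hy'.1
    have e1 : (x ∪ y) \ F = x := by
      rw [Set.union_sdiff_distrib, sdiff_eq_left.2 (Set.disjoint_iff_inter_eq_empty.2 hxF'),
        Set.sdiff_eq_empty.2 hyF, Set.union_empty]
    have e2 : (x ∪ y) ∩ F = y := by
      rw [Set.union_inter_distrib_right, hxF', Set.empty_union, Set.inter_eq_left.2 hyF]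
    have e3 : (x ∪ y) \ M = u := by
      rw [Set.union_sdiff_distrib, Set.sdiff_eq_empty.2 (hyF.trans hFM), Set.union_empty]
      have : x \ M = (x \ (M \ F)) \ F := by rw [Set.sdiff_sdiff, Set.sdiff_union_of_subset hFM]
      rw [this, hx'.1]
      exact sdiff_eq_left.2 huF
    refine Finset.mem_coe.2 (Finset.mem_filter.2 ⟨Finset.mem_filter.2 ⟨Finset.mem_univ _, e3, ?_⟩, e1⟩)
    exact (h (x ∪ y) e3).2 ⟨by rw [e1]; exact hx'.2, by rw [e1, e2]; exact hy'.2⟩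
  · intro a ha
    have hax : a \ F = x := (Finset.mem_filter.1 (Finset.mem_coe.1 ha)).2
    show x ∪ a ∩ F = a
    rw [← hax, Set.sdiff_union_inter]
  · intro y hy
    have hyF : y ⊆ F := (Finset.mem_filter.1 (Finset.mem_coe.1 hy)).2.1
    show (x ∪ y) ∩ F = y
    rw [Set.union_inter_distrib_right, hxF', Set.empty_union, Set.inter_eq_left.2 hyF]

/-- **Forced-open block.**  If `F ⊆ u` (coordinates open in both copies) and `Cond a` only depends on `a \ F`, then
`#{a : a \ M = u, Cond a} = #{x : x \ M = u \ F, Good x}` (the bijection `a ↦ a \ F`). [folklore] -/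
theorem card_filter_fibre_forced (M u F : Set α) (hFu : F ⊆ u) (huM : Disjoint u M)
    (Cond Good : Set α → Prop) (h : ∀ a : Set α, a \ M = u → (Cond a ↔ Good (a \ F))) :
    (Finset.univ.filter fun a : Set α => a \ M = u ∧ Cond a).card =
      (Finset.univ.filter fun x : Set α => x \ M = u \ F ∧ Good x).card := by
  classical
  have hFM : Disjoint F M := huM.mono_left hFu
  refine Finset.card_nbij' (fun a : Set α => a \ F) (fun x : Set α => x ∪ F) ?_ ?_ ?_ ?_
  · intro a ha
    have ha' := (Finset.mem_filter.1 (Finset.mem_coe.1 ha)).2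
    refine Finset.mem_coe.2 (Finset.mem_filter.2 ⟨Finset.mem_univ _, ?_, (h a ha'.1).1 ha'.2⟩)
    rw [Set.sdiff_sdiff_comm, ha'.1]
  · intro x hx
    have hx' := (Finset.mem_filter.1 (Finset.mem_coe.1 hx)).2
    have hxF0 : x ∩ F = ∅ := by
      ext e
      simp only [Set.mem_inter_iff, Set.mem_empty_iff_false, iff_false, not_and]
      intro hex heF
      have : e ∈ x \ M := ⟨hex, fun heM => Set.disjoint_left.1 hFM heF heM⟩
      rw [hx'.1] at this
      exact this.2 heF
    have e1 : (x ∪ F) \ F = x := Set.union_sdiff_cancel_right hxF0.le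
    have e2 : (x ∪ F) \ M = u := by
      rw [Set.union_sdiff_distrib, hx'.1, sdiff_eq_left.2 hFM, Set.sdiff_union_of_subset hFu]
    refine Finset.mem_coe.2 (Finset.mem_filter.2 ⟨Finset.mem_univ _, e2, (h _ e2).2 (by rw [e1]; exact hx'.2)⟩)
  · intro a ha
    have ha' := (Finset.mem_filter.1 (Finset.mem_coe.1 ha)).2
    show a \ F ∪ F = a
    rw [Set.sdiff_union_self, Set.union_eq_left.2]
    rw [← ha'.1] at hFu
    exact fun e he => (hFu he).1
  · intro x hx
    have hx' := (Finset.mem_filter.1 (Finset.mem_coe.1 hx)).2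
    show (x ∪ F) \ F = x
    have hxF0 : x ∩ F = ∅ := by
      ext e
      simp only [Set.mem_inter_iff, Set.mem_empty_iff_false, iff_false, not_and]
      intro hex heF
      have : e ∈ x \ M := ⟨hex, fun heM => Set.disjoint_left.1 hFM heF heM⟩
      rw [hx'.1] at this
      exact this.2 heF
    exact Set.union_sdiff_cancel_right hxF0.le

/-- The block count in the four states: all subsets / only `∅` / only `F` / none (for `F ≠ ∅`). [folklore] -/
theorem card_filter_subset_rel (F : Set α) (hF : F.Nonempty) (p q : Prop) :
    (Finset.univ.filter fun y : Set α => y ⊆ F ∧ ((p → y = ∅) ∧ (q → y = F))).card =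
      (if p then 0 else if q then 0 else (Finset.univ.filter fun y : Set α => y ⊆ F).card) +
        (if p ∧ q then 0 else if p ∨ q then 1 else 0) := by
  classical
  by_cases hp : p <;> by_cases hq : q
  · -- both: no subset is both `∅` and `F`
    simp only [hp, hq, forall_true_left, and_self, ↓reduceIte, add_zero]
    rw [Finset.card_eq_zero, Finset.filter_eq_empty_iff]
    rintro y - ⟨-, hy0, hyF⟩
    obtain ⟨e, he⟩ := hF
    rw [← hyF, hy0] at he
    exact he
  · simp only [hp, hq, forall_true_left, IsEmpty.forall_iff, and_true, ↓reduceIte, and_false, true_or, zero_add]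
    rw [Finset.card_eq_one]
    refine ⟨∅, Finset.eq_singleton_iff_unique_mem.2 ⟨Finset.mem_filter.2 ⟨Finset.mem_univ _, Set.empty_subset _, rfl⟩, ?_⟩⟩
    intro y hy
    exact (Finset.mem_filter.1 hy).2.2
  · simp only [hp, hq, IsEmpty.forall_iff, forall_true_left, true_and, ↓reduceIte, false_and, or_true, zero_add]
    rw [Finset.card_eq_one]
    refine ⟨F, Finset.eq_singleton_iff_unique_mem.2 ⟨Finset.mem_filter.2 ⟨Finset.mem_univ _, subset_rfl, rfl⟩, ?_⟩⟩
    intro y hy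
    exact (Finset.mem_filter.1 hy).2.2
  · simp only [hp, hq, IsEmpty.forall_iff, and_self, and_true, ↓reduceIte, or_self, add_zero]

end Generic


/-! ### Splitting the `B`-condition at the `T`-pairs of one vertex -/

section Star

variable {V : Type*}

/-- **`{S ↮ T}` split at the `T`-pairs of a vertex `v`.**  Let `F` consist of pairs `s(v, t)`, `t ∈ T`.  Then `S ↮ T` in `ω` iff
`S ↮ T` in `ω \ F` and, if `v` is joined to `S` in `ω \ F`, no pair of `F` is open in `ω`.  (⇐: an open path from `S` to `T` in `ω`
uses a first pair of `F`; the vertex before it is `v` — joined to `S` in `ω \ F` — or a vertex of `T` reached in `ω \ F`.) [folklore] -/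
theorem not_reachable_iff_sdiff_star {ω F : BondConfig V} {S T : Set V} {v : V}
    (hF : ∀ e ∈ F, ∃ t ∈ T, e = s(v, t)) :
    (∀ s ∈ S, ∀ t ∈ T, ¬ (openGraph ω).Reachable s t) ↔
      (∀ s ∈ S, ∀ t ∈ T, ¬ (openGraph (ω \ F)).Reachable s t) ∧
        ((∃ s ∈ S, (openGraph (ω \ F)).Reachable s v) → ω ∩ F = ∅) := by
  constructor
  · intro h
    refine ⟨fun s hs t ht hr => h s hs t ht (reachable_of_reachable_sdiff hr), ?_⟩
    rintro ⟨s, hs, hsv⟩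
    ext e
    simp only [Set.mem_inter_iff, Set.mem_empty_iff_false, iff_false, not_and]
    intro heω heF
    obtain ⟨t, ht, rfl⟩ := hF e heF
    have hsv' : (openGraph ω).Reachable s v := reachable_of_reachable_sdiff hsv
    by_cases hvt : v = t
    · exact h s hs t ht (hvt ▸ hsv')
    · exact h s hs t ht (hsv'.trans (SimpleGraph.Adj.reachable ((openGraph_adj ω v t).2 ⟨heω, hvt⟩)))
  · rintro ⟨hB, hv⟩ s hs t ht hst
    rw [SimpleGraph.reachable_iff_reflTransGen] at hst
    -- every vertex reached from `s` in `ω` is reached in `ω \ F`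
    have key : ∀ w, Relation.ReflTransGen (openGraph ω).Adj s w → (openGraph (ω \ F)).Reachable s w := by
      intro w hw
      induction hw with
      | refl => exact SimpleGraph.Reachable.refl s
      | @tail b c _ hbc ih =>
        obtain ⟨hω, hne⟩ := (openGraph_adj ω b c).1 hbc
        by_cases hbcF : s(b, c) ∈ F
        · -- the pair is `s(v, t')`: its endpoint `b` is `v` (joined to `S` off `F`, so `F` is closed) or `t' ∈ T` (unreachable)
          exfalso
          obtain ⟨t', ht', hbt⟩ := hF _ hbcF
          have hb : b = v ∨ b = t' := by
            have : b ∈ s(v, t') := by rw [← hbt]; exact Sym2.mem_mk_left b c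
            exact Sym2.mem_iff.1 this
          rcases hb with rfl | rfl
          · have h0 := hv ⟨s, hs, ih⟩
            have : s(b, c) ∈ ω ∩ F := ⟨hω, hbcF⟩
            rw [h0] at this
            exact this
          · exact hB s hs _ ht' ih
        · exact ih.trans (SimpleGraph.Adj.reachable ((openGraph_adj _ b c).2 ⟨⟨hω, hbcF⟩, hne⟩))
    exact hB s hs t ht (key t hst)

/-- Off `touch T`, removing a block `F ⊆ touch T` first changes nothing: `(a \ F) \ touch T = a \ touch T`. [folklore] -/
theorem sdiff_sdiff_touch_of_subset {a F : BondConfig V} {T : Set V} (hF : F ⊆ {e | ∃ t ∈ T, t ∈ e}) :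
    (a \ F) \ {e | ∃ t ∈ T, t ∈ e} = a \ {e | ∃ t ∈ T, t ∈ e} := by
  rw [Set.sdiff_sdiff, Set.union_eq_right.2 hF]

/-- **Transfer of connections from `S` across the block**: if `S ↮ T` both in `a` and in `a \ F` (`F ⊆ touch T`), the vertices joined
to `S` agree. [folklore] -/
theorem exists_reachable_iff_sdiff_block {a F : BondConfig V} {S T : Set V} (hF : F ⊆ {e | ∃ t ∈ T, t ∈ e})
    (ha : ∀ s ∈ S, ∀ t ∈ T, ¬ (openGraph a).Reachable s t)
    (hx : ∀ s ∈ S, ∀ t ∈ T, ¬ (openGraph (a \ F)).Reachable s t) (w : V) :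
    (∃ s ∈ S, (openGraph a).Reachable s w) ↔ ∃ s ∈ S, (openGraph (a \ F)).Reachable s w := by
  rw [exists_reachable_iff_sdiff_touch ha, exists_reachable_iff_sdiff_touch hx, sdiff_sdiff_touch_of_subset hF]

/-- **Transfer of the union cluster across the block**: if `S ↮ T` both in `a` and in `a \ F` (`F ⊆ touch T`), then
`C_S(a) = C_S(a \ F)`. [folklore] -/
theorem iUnion_openEdgeCluster_eq_sdiff_block {a F : BondConfig V} {S T : Set V} (hF : F ⊆ {e | ∃ t ∈ T, t ∈ e})
    (ha : ∀ s ∈ S, ∀ t ∈ T, ¬ (openGraph a).Reachable s t)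
    (hx : ∀ s ∈ S, ∀ t ∈ T, ¬ (openGraph (a \ F)).Reachable s t) :
    (⋃ s ∈ S, openEdgeCluster a s) = ⋃ s ∈ S, openEdgeCluster (a \ F) s := by
  rw [iUnion_openEdgeCluster_eq_sdiff_touch ha, iUnion_openEdgeCluster_eq_sdiff_touch hx, sdiff_sdiff_touch_of_subset hF]

end Star

end Consts.HardCoreReduction

end Summit.CriticalPhenomena.PercolationContinuityZ3.Theorems
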